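import Summits.QuantumFields.YangMills.Theorems.LuscherReductionTwistedTraceScalingBOCentralQuasimodeRate
import Summits.QuantumFields.YangMills.Theorems.LuscherReductionTwistedTraceScalingBODefectCoreSq
import Summits.QuantumFields.YangMills.Theorems.LuscherReductionTwistedTraceScalingBODefectCoreData
import HarnessLib

/-!
# (C4)-CORE ★★★ THE RECORD INSTANCE: the weighted `L²` size of the CORE quasimode defect of the record data, with the explicit rate (schedule B)
# (lane A of S-BASE, crux `TwistedTraceScaling` stmt-QuantumFields-20203, C4-CORE, the (OD) pen; `pub/ym-fleet/ym-luscher-20007-p1/HANDOFF-g19.md` step (1))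

`…BODefectCoreSq.defect_core_sq_integral_le` instantiated with the record data: weight `χ = recordChi L s 43 M β` (record shape, (P) from
`…FPWeightCore.fpWeight_core_constant`, `κ_P = C_p(43β^{-s})²`), profile `Ω_c` (cap-restricted frozen stiff Gaussian, radius `r_f`), the CORE PART of the transfer
`K_core(U) := Z⁻¹∫_u φ(u)·(∫_c fpFibreTransfer β Ω_c W_core (c⁻¹Uc) u dc) du` (`W_core = coreWeight ε R₁'`; the full transfer `K̃(φ⊗Ω_c)` is `K_core +` the FP-tail part
— `transferApply_boFun_eq_fp` with `W = fpWeight = coreWeight + tailWeight` — and the tail is a (C5) item), slow factors `P = ∫φρ̃`, `P_a = ∫|φ|ρ̃`, and the pointwise core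
defect WITH RATE `…BOCentralQuasimodeRate.core_defect_rate` (`ε_s(β)`; windows `δ = D·β^{-s}`, `δu = 14β^{-s}`, `σ = β^{-2s}`), then `…BODefectCoreData.sq_integral_slowPa_le`:
★★★ `core_defect_rate_floor` (= `core_defect_rate` re-proved with the SAME `c₁` as the central quasimode floor, exported) and ★★★ `defect_core_record`: for `0 < s ≤ 1/3`, `M ≥ M₀(L)` (independent of `D`) and then any `D ≥ 0`, there are `c₁ : ℝ → ℝ`, `C_p ≥ 0` with, eventually in `β` (and `0 < c₁ β`, `κ_P < 1`), for every bounded measurable `φ`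
supported in the input window,
`∫ 𝟙_{S_in}·(K_core/w − boFun ψ_φ Ω_c)²·w ≤ (Z⁻¹a₀(ε_s + κ_P))²/(N̄(1−κ_P)) · M₂^{γ,in} · (linkCE(L³β)/K₁(1,1))²·∫φ²`,
`a₀ = c₁(β)·stiffGaussTop/I₀`, `ψ_φ = Z⁻¹a₀P/N̄`, `M₂^{γ,in} = ∫ 𝟙_{‖x‖≤r_f/12}e^{−2q}e^{−‖P_Γx‖²β²}dπ`, `S_in = {U ∈ orthoTubeSet : χU ≠ 0, ‖relLinkVec U‖ ≤ r_f/12, slowMean U ∈ W_out}`.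
Also `measurable_coreTransferApply` (joint measurability of `K_core`).
HONEST FRAMING: (C4)-core in record form; the FP-tail/shell/far/gauge-far parts (C5), the mass ratio, the final `b`, (B-ST), C4-CORE OPEN; conditional route R2b1; not a gap, not Clay.
-/

set_option autoImplicit false

noncomputable section

open MeasureTheory Filter Topology Real
open scoped BigOperators RealInnerProductSpace
open Literature.MathematicalPhysics.QuantumFieldTheory
open Literature.MathematicalPhysics.QuantumLattice

namespace Summit.QuantumFields.YangMills.Theorems.FemtoTransferGap.TwoLattice.ConstTube

open Summit.QuantumFields.YangMills.Theorems.FemtoTransferGap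
open Summit.QuantumFields.YangMills.Theorems.FemtoTransferGap.TwoLattice
open Summit.QuantumFields.YangMills.Theorems.FemtoTransferGap.TwoLattice.Avg
open Summit.QuantumFields.YangMills.Theorems.FemtoTransferGap.TwoLattice.Stiff
open Summit.QuantumFields.YangMills.Theorems.FemtoTransferGap.TwoLattice.GnChart

variable {L : ℕ} [NeZero L]

/-! ## §1 Measurability of the core transfer `U ↦ ∫_u φ(u)·(∫_c fpFibreTransfer (c⁻¹Uc) u dc) du` -/

/-- Joint measurability in `(U, u)` of the colour-integrated fibre transfer `∫_c fpFibreTransfer β Ω W (c⁻¹Uc) u dc` (bounded measurable `Ω, W`). [folklore] -/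
theorem measurable_colour_fpFibreTransfer_uncurry (β : ℝ) {Ω : LinkSpace L → ℝ} (hΩ : Measurable Ω) {W : (Site 3 L → SU2) → ℝ} (hW : Measurable W) :
    Measurable fun p : GaugeConfig 3 L SU2 × GaugeConfig 3 1 SU2 => ∫ c, fpFibreTransfer L β Ω W (gaugeTransform (fun _ : Site 3 L => c⁻¹) p.1) p.2 ∂haarProbability SU2 := by
  haveI : SecondCountableTopology SU2 := secondCountableTopology_su2
  haveI := isFiniteMeasure_orthoTransverse L
  have hK : Measurable fun p : GaugeConfig 3 L SU2 × GaugeConfig 3 L SU2 => transferKernel su2Rep β p.1 p.2 :=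
    (continuous_transferKernel su2Rep continuous_su2Rep β).measurable
  -- the integrand on `(((U, u), c), (v, g))`
  have h1 : Measurable fun q : ((GaugeConfig 3 L SU2 × GaugeConfig 3 1 SU2) × SU2) × ((Edge 3 L → Fin 3 → ℝ) × (Site 3 L → SU2)) =>
      gaugeTransform (fun _ : Site 3 L => q.1.2⁻¹) q.1.1.1 := by
    have ha : Measurable fun q : ((GaugeConfig 3 L SU2 × GaugeConfig 3 1 SU2) × SU2) × ((Edge 3 L → Fin 3 → ℝ) × (Site 3 L → SU2)) => (q.1.1.1, q.1.2⁻¹) :=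
      ((measurable_fst.comp measurable_fst).comp measurable_fst).prodMk (measurable_snd.comp measurable_fst).inv
    have h := (measurable_constGaugeAction (L := L)).comp ha
    simpa only [Function.comp_def] using h
  have h2 : Measurable fun q : ((GaugeConfig 3 L SU2 × GaugeConfig 3 1 SU2) × SU2) × ((Edge 3 L → Fin 3 → ℝ) × (Site 3 L → SU2)) =>
      gaugeTransform q.2.2 (orthoTube L q.1.1.2 q.2.1) := by
    have hf : Measurable fun q : ((GaugeConfig 3 L SU2 × GaugeConfig 3 1 SU2) × SU2) × ((Edge 3 L → Fin 3 → ℝ) × (Site 3 L → SU2)) => (q.1.1.2, q.2.1) :=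
      ((measurable_snd.comp measurable_fst).comp measurable_fst).prodMk (measurable_fst.comp measurable_snd)
    have ho' := (measurable_orthoTube_uncurry (L := L)).comp hf
    have ho : Measurable fun q : ((GaugeConfig 3 L SU2 × GaugeConfig 3 1 SU2) × SU2) × ((Edge 3 L → Fin 3 → ℝ) × (Site 3 L → SU2)) => orthoTube L q.1.1.2 q.2.1 := by
      simpa only [Function.comp_def] using ho'
    have hg : Measurable fun q : ((GaugeConfig 3 L SU2 × GaugeConfig 3 1 SU2) × SU2) × ((Edge 3 L → Fin 3 → ℝ) × (Site 3 L → SU2)) => (orthoTube L q.1.1.2 q.2.1, q.2.2) :=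
      ho.prodMk (measurable_snd.comp measurable_snd)
    have h := (measurable_gaugeAction (L := L)).comp hg
    simpa only [Function.comp_def] using h
  have h3 : Measurable fun q : ((GaugeConfig 3 L SU2 × GaugeConfig 3 1 SU2) × SU2) × ((Edge 3 L → Fin 3 → ℝ) × (Site 3 L → SU2)) =>
      transferKernel su2Rep β (gaugeTransform (fun _ : Site 3 L => q.1.2⁻¹) q.1.1.1) (gaugeTransform q.2.2 (orthoTube L q.1.1.2 q.2.1)) := by
    have h := hK.comp (h1.prodMk h2); simpa only [Function.comp_def] using h
  have hF : Measurable fun q : ((GaugeConfig 3 L SU2 × GaugeConfig 3 1 SU2) × SU2) × ((Edge 3 L → Fin 3 → ℝ) × (Site 3 L → SU2)) =>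
      W q.2.2 * transferKernel su2Rep β (gaugeTransform (fun _ : Site 3 L => q.1.2⁻¹) q.1.1.1) (gaugeTransform q.2.2 (orthoTube L q.1.1.2 q.2.1)) * Ω (linkEmbed L q.2.1) :=
    ((hW.comp (measurable_snd.comp measurable_snd)).mul h3).mul (hΩ.comp ((measurable_linkEmbed L).comp (measurable_fst.comp measurable_snd)))
  have hI := (hF.stronglyMeasurable.integral_prod_right' (ν := (orthoTransverse L).prod (gaugeMeasure L))).measurable
  have hI' : Measurable fun r : (GaugeConfig 3 L SU2 × GaugeConfig 3 1 SU2) × SU2 => fpFibreTransfer L β Ω W (gaugeTransform (fun _ : Site 3 L => r.2⁻¹) r.1.1) r.1.2 := by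
    unfold fpFibreTransfer; simpa only using hI
  have hJ := (hI'.stronglyMeasurable.integral_prod_right' (ν := haarProbability SU2)).measurable
  simpa only using hJ

/-- ★ `U ↦ Z⁻¹·∫_u φ(u)·(∫_c fpFibreTransfer β Ω W (c⁻¹Uc) u dc) du` is measurable (measurable `φ`, bounded measurable `Ω, W`). [folklore] -/
theorem measurable_coreTransferApply (β : ℝ) {Ω : LinkSpace L → ℝ} (hΩ : Measurable Ω) {W : (Site 3 L → SU2) → ℝ} (hW : Measurable W) {φ : GaugeConfig 3 1 SU2 → ℝ}
    (hφ : Measurable φ) (Zi : ℝ) :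
    Measurable fun U : GaugeConfig 3 L SU2 => Zi * ∫ u, φ u * (∫ c, fpFibreTransfer L β Ω W (gaugeTransform (fun _ : Site 3 L => c⁻¹) U) u ∂haarProbability SU2) ∂configMeasure SU2 1 := by
  have hm : Measurable (Function.uncurry fun (U : GaugeConfig 3 L SU2) (u : GaugeConfig 3 1 SU2) =>
      φ u * ∫ c, fpFibreTransfer L β Ω W (gaugeTransform (fun _ : Site 3 L => c⁻¹) U) u ∂haarProbability SU2) :=
    (hφ.comp measurable_snd).mul (measurable_colour_fpFibreTransfer_uncurry β hΩ hW)
  exact ((hm.stronglyMeasurable.integral_prod_right' (ν := configMeasure SU2 1)).measurable).const_mul Zi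

/-! ## §2 The core defect rate sharing its constant with the central quasimode -/

open Summit.QuantumFields.YangMills.Theorems.TwistedTraceScaling.Negative in
set_option maxHeartbeats 800000 in
-- explicit schedule-B profile, weight, windows and transport exponent in the statement; the instantiation of
-- `core_transfer_defect_le_inner` exceeds the default budget.
/-- ★★★ **THE CORE DEFECT WITH RATE, SHARING ITS CONSTANT WITH THE QUASIMODE**: `…BOCentralQuasimodeRate.core_defect_rate` re-proved so that the SAME `c₁` also carries the
central quasimode two-sided bound of `central_quasimode_rate` (the (B-OD) currency needs both with one `c₁`), for every `D`. [cite: Luscher1983, §3] -/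
theorem core_defect_rate_floor (hL : Nonempty (NzSite L)) {s : ℝ} (hs : 0 < s) :
    ∃ c₁ : ℝ → ℝ, (∀ᶠ β : ℝ in atTop, 0 < c₁ β ∧ ∀ v' : Edge 3 L → Fin 3 → ℝ, v' ∈ capBalancedSet L →
      (∀ (e : Edge 3 L) (c : Fin 3), |v' e c| ≤ (9 * (L : ℝ) * (5 * (powScale (1 / 2) β * btLog β ^ 2)) + (powScale 1 β))) → ‖linkEmbed L v'‖ ≤ (min (1 / 40) (powScale (1 / 2) β * btLog β)) / 12 →
      |fpFibreTransfer L β (fun x : LinkSpace L => {x : LinkSpace L | linkCurry x ∈ capBalancedSet L}.indicator (fun _ => (1 : ℝ)) x * frozenProfile L (fun β' => stiffGaussExp L (β' / 2) β') (fun β' => min (1 / 40) (powScale (1 / 2) β' * btLog β')) β x) (coreWeight L (powScale 1 β) (5 * (powScale (1 / 2) β * btLog β ^ 2))) (orthoTube L 1 v') 1 - c₁ β * ((stiffGaussTop L (β / 2) β * Real.exp (-stiffGaussExp L (β / 2) β (linkEmbed L v'))) / (∫ u, ({u : GaugeConfig 3 1 SU2 | (∀ k : Fin 3, ‖su2Quat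 (u (0, k)) - 1‖ ≤ (powScale (1 / 3) β)) ∧ (L : ℝ) ^ 3 * wilsonAction su2Rep u ≤ (powScale (1 / 2) β)}.indicator (fun _ => (1 : ℝ))) u * (transferKernel su2Rep ((L : ℝ) ^ 3 * β) (1 : GaugeConfig 3 1 SU2) u / transferKernel su2Rep ((L : ℝ) ^ 3 * β) (1 : GaugeConfig 3 1 SU2) 1)
            ∂configMeasure SU2 1))| ≤ powScale (1 / 5) β * (c₁ β * ((stiffGaussTop L (β / 2) β * Real.exp (-stiffGaussExp L (β / 2) β (linkEmbed L v'))) / (∫ u, ({u : GaugeConfig 3 1 SU2 | (∀ k : Fin 3, ‖su2Quat (u (0, k)) - 1‖ ≤ (powScale (1 / 3) β)) ∧ (L : ℝ) ^ 3 * wilsonAction su2Rep u ≤ (powScale (1 / 2) β)}.indicator (fun _ => (1 : ℝ))) u * (transferKernel su2Rep ((L : ℝ) ^ 3 * β) (1 : GaugeConfig 3 1 SU2) u / transferKernel su2Rep ((L : ℝ) ^ 3 * β) (1 : GaugeConfig 3 1 SU2) 1)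
            ∂configMeasure SU2 1)))) ∧ ∀ D : ℝ, ∀ᶠ β : ℝ in atTop, 0 < c₁ β ∧ ∀ u' : GaugeConfig 3 1 SU2,
      (∀ k : Fin 3, ‖su2Quat (u' (0, k)) - 1‖ ≤ (D * powScale s β)) → (L : ℝ) ^ 3 * wilsonAction su2Rep u' ≤ (powScale (2 * s) β) →
      ∀ v' : Edge 3 L → Fin 3 → ℝ, v' ∈ capBalancedSet L → (∀ e : Edge 3 L, ∑ a, v' e a ^ 2 ≤ (9 * (L : ℝ) * (5 * (powScale (1 / 2) β * btLog β ^ 2)) + (powScale 1 β)) ^ 2) → ‖linkEmbed L v'‖ ≤ (min (1 / 40) (powScale (1 / 2) β * btLog β)) / 12 →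
      ∀ φ : GaugeConfig 3 1 SU2 → ℝ, Measurable φ → ∀ Cφ : ℝ, (∀ u, |φ u| ≤ Cφ) →
      (∀ u, φ u ≠ 0 → (∀ k : Fin 3, ‖su2Quat (u (0, k)) - 1‖ ≤ (14 * powScale s β)) ∧ (L : ℝ) ^ 3 * wilsonAction su2Rep u ≤ (powScale (2 * s) β)) →
      |(∫ u, φ u * (∫ c, fpFibreTransfer L β (fun x : LinkSpace L => {x : LinkSpace L | linkCurry x ∈ capBalancedSet L}.indicator (fun _ => (1 : ℝ)) x * frozenProfile L (fun β' => stiffGaussExp L (β' / 2) β') (fun β' => min (1 / 40) (powScale (1 / 2) β' * btLog β')) β x) (coreWeight L (powScale 1 β) (5 * (powScale (1 / 2) β * btLog β ^ 2))) (gaugeTransform (fun _ : Site 3 L => c⁻¹) (orthoTube L u' v')) u ∂haarProbability SU2) ∂configMeasure SU2 1) - c₁ β * ((stiffGaussTop L (β / 2) β * Real.exp (-stiffGaussExp L (β / 2) β (linkEmbed L v'))) / (∫ u, ({u : GaugeConfig 3 1 SU2 | (∀ k : Fin 3, ‖su2Quat (u (0, k)) - 1‖ ≤ (powScale (1 / 3)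 β)) ∧ (L : ℝ) ^ 3 * wilsonAction su2Rep u ≤ (powScale (1 / 2) β)}.indicator (fun _ => (1 : ℝ))) u * (transferKernel su2Rep ((L : ℝ) ^ 3 * β) (1 : GaugeConfig 3 1 SU2) u / transferKernel su2Rep ((L : ℝ) ^ 3 * β) (1 : GaugeConfig 3 1 SU2) 1)
            ∂configMeasure SU2 1)) * ∫ u, φ u * (avgKernel ((L : ℝ) ^ 3 * β) u' u / transferKernel su2Rep ((L : ℝ) ^ 3 * β) (1 : GaugeConfig 3 1 SU2) 1) ∂configMeasure SU2 1| ≤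
        max (1 - Real.exp (-(coreEta L β (D * powScale s β) ((D * powScale s β) + (14 * powScale s β)) (9 * (L : ℝ) * (5 * (powScale (1 / 2) β * btLog β ^ 2)) + (powScale 1 β)) (min (1 / 40) (powScale (1 / 2) β * btLog β)) ((powScale 1 β) * Fintype.card (Site 3 L)) (powScale (2 * s) β) + coreEps1 L β (D * powScale s β) (9 * (L : ℝ) * (5 * (powScale (1 / 2) β * btLog β ^ 2)) + (powScale 1 β)) (min (1 / 40) (powScale (1 / 2) β * btLog β)) + coreEps2 L β (D * powScale s β) (9 * (L : ℝ) * (5 * (powScale (1 / 2) β * btLog β ^ 2)) + (powScale 1 β)) (min (1 / 40) (powScale (1 / 2) β * btLog β)) (powScale (2 * s) β))) * (1 - powScale (1 / 5) β)) (Real.exp (coreEta L β (D * powScale s β) ((D * powScale s β) + (14 * powScale s β)) (9 * (L : ℝ) * (5 * (powScale (1 / 2) β * btLog β ^ 2)) + (powScale 1 β)) (min (1 / 40) (powScale (1 / 2) β * btLog β)) ((powScale 1 β) * Fintype.card (Site 3 L)) (powScale (2 * s) β) + coreEps1 L β (D * powScale s β) (9 * (L : ℝ) * (5 * (powScale (1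 / 2) β * btLog β ^ 2)) + (powScale 1 β)) (min (1 / 40) (powScale (1 / 2) β * btLog β)) + coreEps2 L β (D * powScale s β) (9 * (L : ℝ) * (5 * (powScale (1 / 2) β * btLog β ^ 2)) + (powScale 1 β)) (min (1 / 40) (powScale (1 / 2) β * btLog β)) (powScale (2 * s) β)) * (1 + powScale (1 / 5) β) - 1) * (c₁ β * ((stiffGaussTop L (β / 2) β * Real.exp (-stiffGaussExp L (β / 2) β (linkEmbed L v'))) / (∫ u, ({u : GaugeConfig 3 1 SU2 | (∀ k : Fin 3, ‖su2Quat (u (0, k)) - 1‖ ≤ (powScale (1 / 3) β)) ∧ (L : ℝ) ^ 3 * wilsonAction su2Rep u ≤ (powScale (1 / 2) β)}.indicator (fun _ => (1 : ℝ))) u * (transferKernel su2Rep ((L : ℝ) ^ 3 * β) (1 : GaugeConfig 3 1 SU2) u / transferKernel su2Rep ((L : ℝ) ^ 3 * β) (1 : GaugeConfig 3 1 SU2) 1)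
            ∂configMeasure SU2 1)) * ∫ u, |φ u| * (avgKernel ((L : ℝ) ^ 3 * β) u' u / transferKernel su2Rep ((L : ℝ) ^ 3 * β) (1 : GaugeConfig 3 1 SU2) 1) ∂configMeasure SU2 1) := by
  obtain ⟨c₁, hq⟩ := central_quasimode_rate (L := L) hL
  refine ⟨c₁, hq, fun D => ?_⟩
  have ea : ∀ᶠ β : ℝ in atTop, (D * powScale s β) ≤ 1 / 2 := by
    have h := eventually_mul_le_of_tendsto (tendsto_powScale (σ := s) hs) D (by norm_num : (0:ℝ) < 1 / 2)
    exact h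
  have eb : ∀ᶠ β : ℝ in atTop, (D * powScale s β) + (14 * powScale s β) ≤ 1 := by
    have h := eventually_mul_le_of_tendsto (tendsto_powScale (σ := s) hs) (D + 14) one_pos
    filter_upwards [h] with β hβ
    linarith
  have eT : ∀ᶠ β : ℝ in atTop, (9 * (L : ℝ) * (5 * (powScale (1 / 2) β * btLog β ^ 2)) + (powScale 1 β)) ≤ 1 / 30 := (tendsto_schedT (L := L)).eventually (eventually_le_nhds (by norm_num))
  have e37 : ∀ᶠ β : ℝ in atTop, (min (1 / 40) (powScale (1 / 2) β * btLog β)) ≤ (9 * (L : ℝ) * (5 * (powScale (1 / 2) β * btLog β ^ 2)) + (powScale 1 β)) ∧ 3 * L * (5 * (powScale (1 / 2) β * btLog β ^ 2)) < 1 := by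
    have h3 := eventually_mul_lt_of_tendsto (tendsto_powScale_mul_btLog_pow (p := 1 / 2) (by norm_num) 2) (3 * (L : ℝ) * 5) one_pos
    filter_upwards [h3] with β h
    refine ⟨rf_le_schedT (L := L) β, ?_⟩
    calc 3 * L * (5 * (powScale (1 / 2) β * btLog β ^ 2)) = (3 * (L : ℝ) * 5) * (powScale (1 / 2) β * btLog β ^ 2) := by ring
      _ < 1 := h
  filter_upwards [hq, ea, eb, eT, e37, eventually_ge_atTop (1 : ℝ)] with β hQ ha hab hTs h37 hβ1
  obtain ⟨hc₁, hC1⟩ := hQ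
  refine ⟨hc₁, fun u' hu' hS' v' hv' hv'T hx' φ hφm Cφ hCφ hφw => ?_⟩
  have hβ : (0 : ℝ) ≤ β := by linarith
  have hβp : (0 : ℝ) < β := by linarith
  have hs1 : 0 < powScale 1 β := powScale_pos _ _
  have hℓ0 : 0 ≤ btLog β := le_trans zero_le_one (one_le_btLog β)
  have hx0 : 0 < powScale (1 / 2) β := powScale_pos _ _
  have hT0 : 0 ≤ (9 * (L : ℝ) * (5 * (powScale (1 / 2) β * btLog β ^ 2)) + (powScale 1 β)) := by positivity
  -- the data
  have hqfm : ∀ β', Measurable ((fun β'' : ℝ => stiffGaussExp L (β'' / 2) β'') β') := fun β' => measurable_stiffGaussExp _ _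
  have hqf0 : ∀ β' x, 0 ≤ (fun β'' : ℝ => stiffGaussExp L (β'' / 2) β'') β' x := fun β' x => stiffGaussExp_nonneg _ _ x
  have hΩGm : Measurable (frozenProfile L (fun β' => stiffGaussExp L (β' / 2) β') (fun β' => min (1 / 40) (powScale (1 / 2) β' * btLog β')) β) :=
    measurable_frozenProfile hqfm _ β
  have hΩG0 : ∀ x, 0 ≤ frozenProfile L (fun β' => stiffGaussExp L (β' / 2) β') (fun β' => min (1 / 40) (powScale (1 / 2) β' * btLog β')) β x :=
    fun x => (frozenProfile_mem_Icc hqf0 _ β x).1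
  have hΩG1 : ∀ x, |frozenProfile L (fun β' => stiffGaussExp L (β' / 2) β') (fun β' => min (1 / 40) (powScale (1 / 2) β' * btLog β')) β x| ≤ 1 :=
    abs_frozenProfile_le hqf0 _ β
  have hΩm := measurable_capRestrict (L := L) hΩGm
  have hΩdat := fun x => capRestrict_mem (L := L) hΩG0 hΩG1 x
  have hWc := fun g (hg : coreWeight L (powScale 1 β) (5 * (powScale (1 / 2) β * btLog β ^ 2)) g ≠ 0) => coreWeight_support (L := L) hs1.le h37.2 hg
  have hΩt : ∀ v : Edge 3 L → Fin 3 → ℝ, (fun x : LinkSpace L => {x : LinkSpace L | linkCurry x ∈ capBalancedSet L}.indicator (fun _ => (1 : ℝ)) x * frozenProfile L (fun β' => stiffGaussExp L (β' / 2) β') (fun β' => min (1 / 40) (powScale (1 / 2) β' * btLog β')) β x) (linkEmbed L v) ≠ 0 →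
      v ∈ capBalancedSet L ∧ (∀ (e : Edge 3 L) (c : Fin 3), |v e c| ≤ (9 * (L : ℝ) * (5 * (powScale (1 / 2) β * btLog β ^ 2)) + (powScale 1 β))) ∧ ‖linkEmbed L v‖ ≤ (min (1 / 40) (powScale (1 / 2) β * btLog β)) := fun v hv => by
    obtain ⟨hcap, hvc, hvn⟩ := capRestrict_frozenProfile_support (L := L) _ _ β v hv
    exact ⟨hcap, fun e c => (hvc e c).trans h37.1, hvn⟩
  have hPinv : ∀ (g : SU2) (x : LinkSpace L), (fun x : LinkSpace L => (stiffGaussTop L (β / 2) β * Real.exp (-stiffGaussExp L (β / 2) β x)) / (∫ u, ({u : GaugeConfig 3 1 SU2 | (∀ k : Fin 3, ‖su2Quat (u (0, k)) - 1‖ ≤ (powScale (1 / 3) β)) ∧ (L : ℝ) ^ 3 * wilsonAction su2Rep u ≤ (powScale (1 / 2) β)}.indicator (fun _ => (1 : ℝ))) u * (transferKernel su2Rep ((L : ℝ) ^ 3 * β) (1 : GaugeConfig 3 1 SU2) u / transferKernel su2Rep ((L : ℝ) ^ 3 * β) (1 : GaugeConfig 3 1 SU2) 1)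
            ∂configMeasure SU2 1)) (adL L g x) = (fun x : LinkSpace L => (stiffGaussTop L (β / 2) β * Real.exp (-stiffGaussExp L (β / 2) β x)) / (∫ u, ({u : GaugeConfig 3 1 SU2 | (∀ k : Fin 3, ‖su2Quat (u (0, k)) - 1‖ ≤ (powScale (1 / 3) β)) ∧ (L : ℝ) ^ 3 * wilsonAction su2Rep u ≤ (powScale (1 / 2) β)}.indicator (fun _ => (1 : ℝ))) u * (transferKernel su2Rep ((L : ℝ) ^ 3 * β) (1 : GaugeConfig 3 1 SU2) u / transferKernel su2Rep ((L : ℝ) ^ 3 * β) (1 : GaugeConfig 3 1 SU2) 1)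
            ∂configMeasure SU2 1)) x := fun g x => by
    simp only [stiffGaussExp_adL]
  obtain ⟨hSlo, -⟩ := stiffGaussTop_record_bounds (L := L) hβp
  have hS : 0 < stiffGaussTop L (β / 2) β := lt_of_lt_of_le (pow_pos (Real.sqrt_pos.2 (by positivity)) _) hSlo
  have hI0 := slowWindow_I0_pos (L := L) (powScale_pos (1 / 3) β) (powScale_pos (1 / 2) β) ((L : ℝ) ^ 3 * β)
  have hP0 : ∀ x : LinkSpace L, 0 ≤ (fun x : LinkSpace L => (stiffGaussTop L (β / 2) β * Real.exp (-stiffGaussExp L (β / 2) β x)) / (∫ u, ({u : GaugeConfig 3 1 SU2 | (∀ k : Fin 3, ‖su2Quat (u (0, k)) - 1‖ ≤ (powScale (1 / 3) β)) ∧ (L : ℝ) ^ 3 * wilsonAction su2Rep u ≤ (powScale (1 / 2) β)}.indicator (fun _ => (1 : ℝ))) u * (transferKernel su2Rep ((L : ℝ) ^ 3 * β) (1 : GaugeConfig 3 1 SU2) u / transferKernel su2Rep ((L : ℝ) ^ 3 * β) (1 : GaugeConfig 3 1 SU2) 1)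
            ∂configMeasure SU2 1)) x := fun x => by positivity
  have hrf0 : 0 ≤ (min (1 / 40) (powScale (1 / 2) β * btLog β)) := le_min (by norm_num) (mul_nonneg hx0.le hℓ0)
  have hσ2 : (powScale (2 * s) β) < 2 := lt_of_le_of_lt (powScale_le_one (by linarith) β) (by norm_num)
  exact core_transfer_defect_le_inner (L := L) hβ hΩm (fun x => (hΩdat x).2.2) (fun x => (hΩdat x).1) (measurable_coreWeight (L := L) _ _)
    (abs_coreWeight_le (L := L) _ _) (fun g => (coreWeight_mem_Icc (L := L) _ _ g).1) ha hab hT0 hTs hσ2 hΩt hWc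
    (P := (fun x : LinkSpace L => (stiffGaussTop L (β / 2) β * Real.exp (-stiffGaussExp L (β / 2) β x)) / (∫ u, ({u : GaugeConfig 3 1 SU2 | (∀ k : Fin 3, ‖su2Quat (u (0, k)) - 1‖ ≤ (powScale (1 / 3) β)) ∧ (L : ℝ) ^ 3 * wilsonAction su2Rep u ≤ (powScale (1 / 2) β)}.indicator (fun _ => (1 : ℝ))) u * (transferKernel su2Rep ((L : ℝ) ^ 3 * β) (1 : GaugeConfig 3 1 SU2) u / transferKernel su2Rep ((L : ℝ) ^ 3 * β) (1 : GaugeConfig 3 1 SU2) 1)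
            ∂configMeasure SU2 1))) hP0 hPinv hc₁.le (by linarith [hrf0]) hC1 u' hu' hS' hv' hv'T hx' hφm hCφ hφw

/-! ## §3 ★★★ The record instance -/

open Summit.QuantumFields.YangMills.Theorems.TwistedTraceScaling.Negative in
set_option maxHeartbeats 1600000 in
-- explicit schedule-B data in the statement and an instantiation of `defect_core_sq_integral_le` with ~2k-character arguments.
/-- ★★★ **THE (C4)-CORE `L²` ESTIMATE OF RECORD** (see the module docstring). [cite: Luscher1983, §3] [cite: SjostrandZworski2007, §2] -/
theorem defect_core_record (hL : Nonempty (NzSite L)) {s : ℝ} (hs : 0 < s) (hs3 : s ≤ 1 / 3) :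
    ∃ M₀ : ℝ, 2 ≤ M₀ ∧ ∀ M : ℝ, M₀ ≤ M → ∀ D : ℝ, 0 ≤ D → ∃ (c₁ : ℝ → ℝ) (Cp : ℝ), 0 ≤ Cp ∧ ∀ᶠ β : ℝ in atTop, 0 < c₁ β ∧ (Cp * (43 * powScale s β) ^ 2) < 1 ∧
      (∀ v' : Edge 3 L → Fin 3 → ℝ, v' ∈ capBalancedSet L →
      (∀ (e : Edge 3 L) (c : Fin 3), |v' e c| ≤ (9 * (L : ℝ) * (5 * (powScale (1 / 2) β * btLog β ^ 2)) + (powScale 1 β))) → ‖linkEmbed L v'‖ ≤ (min (1 / 40) (powScale (1 / 2) β * btLog β)) / 12 →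
      |fpFibreTransfer L β (fun x : LinkSpace L => {x : LinkSpace L | linkCurry x ∈ capBalancedSet L}.indicator (fun _ => (1 : ℝ)) x * frozenProfile L (fun β' => stiffGaussExp L (β' / 2) β') (fun β' => min (1 / 40) (powScale (1 / 2) β' * btLog β')) β x) (coreWeight L (powScale 1 β) (5 * (powScale (1 / 2) β * btLog β ^ 2))) (orthoTube L 1 v') 1 - c₁ β * ((stiffGaussTop L (β / 2) β * Real.exp (-stiffGaussExp L (β / 2) β (linkEmbed L v'))) / (∫ u, ({u : GaugeConfig 3 1 SU2 | (∀ k : Fin 3, ‖su2Quat (u (0, k)) - 1‖ ≤ (powScale (1 / 3) β)) ∧ (L : ℝ) ^ 3 * wilsonAction su2Rep u ≤ (powScale (1 / 2) β)}.indicator (fun _ => (1 : ℝ))) u * (transferKernel su2Rep ((L : ℝ) ^ 3 * β) (1 : GaugeConfig 3 1 SU2) u / transferKernel su2Rep ((L : ℝ) ^ 3 * β) (1 : GaugeConfig 3 1 SU2) 1)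
            ∂configMeasure SU2 1))| ≤ powScale (1 / 5) β * (c₁ β * ((stiffGaussTop L (β / 2) β * Real.exp (-stiffGaussExp L (β / 2) β (linkEmbed L v'))) / (∫ u, ({u : GaugeConfig 3 1 SU2 | (∀ k : Fin 3, ‖su2Quat (u (0, k)) - 1‖ ≤ (powScale (1 / 3) β)) ∧ (L : ℝ) ^ 3 * wilsonAction su2Rep u ≤ (powScale (1 / 2) β)}.indicator (fun _ => (1 : ℝ))) u * (transferKernel su2Rep ((L : ℝ) ^ 3 * β) (1 : GaugeConfig 3 1 SU2) u / transferKernel su2Rep ((L : ℝ) ^ 3 * β) (1 : GaugeConfig 3 1 SU2) 1)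
            ∂configMeasure SU2 1)))) ∧
      ∀ φ : GaugeConfig 3 1 SU2 → ℝ, Measurable φ → ∀ Cφ : ℝ, (∀ u, |φ u| ≤ Cφ) →
      (∀ u, φ u ≠ 0 → (∀ k : Fin 3, ‖su2Quat (u (0, k)) - 1‖ ≤ (14 * powScale s β)) ∧ (L : ℝ) ^ 3 * wilsonAction su2Rep u ≤ (powScale (2 * s) β)) →
      ∫ U, {U : GaugeConfig 3 L SU2 | U ∈ orthoTubeSet L ∧ (recordChi L s 43 M β) U ≠ 0 ∧ ‖relLinkVec L U‖ ≤ (min (1 / 40) (powScale (1 / 2) β * btLog β)) / 12 ∧ slowMean L U ∈ {u : GaugeConfig 3 1 SU2 | (∀ k : Fin 3, ‖su2Quat (u (0, k)) - 1‖ ≤ (D * powScale s β)) ∧ (L : ℝ) ^ 3 * wilsonAction su2Rep u ≤ (powScale (2 * s) β)}}.indicator (fun _ => (1 : ℝ)) U *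
          (((fun U : GaugeConfig 3 L SU2 => (fpZ (powScale 1 β))⁻¹ * ∫ u, φ u * (∫ c, fpFibreTransfer L β (fun x : LinkSpace L => {x : LinkSpace L | linkCurry x ∈ capBalancedSet L}.indicator (fun _ => (1 : ℝ)) x * frozenProfile L (fun β' => stiffGaussExp L (β' / 2) β') (fun β' => min (1 / 40) (powScale (1 / 2) β' * btLog β')) β x) (coreWeight L (powScale 1 β) (5 * (powScale (1 / 2) β * btLog β ^ 2))) (gaugeTransform (fun _ : Site 3 L => c⁻¹) U) u ∂haarProbability SU2) ∂configMeasure SU2 1) U / softWeight (recordChi L s 43 M β) U - boFun L (fun u' => (fpZ (powScale 1 β))⁻¹ * (c₁ β * stiffGaussTop L (β / 2) β / (∫ u, ({u : GaugeConfig 3 1 SU2 | (∀ k : Fin 3, ‖su2Quat (u (0, k)) - 1‖ ≤ (powScale (1 / 3) β)) ∧ (L : ℝ) ^ 3 * wilsonAction su2Rep u ≤ (powScale (1 / 2) β)}.indicator (fun _ => (1 : ℝ))) u * (transferKernel su2Rep ((L : ℝ) ^ 3 * β) (1 : GaugeConfig 3 1 SU2) u / transferKernel su2Rep ((L : ℝ)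 ^ 3 * β) (1 : GaugeConfig 3 1 SU2) 1)
            ∂configMeasure SU2 1)) / (fpWeightBar L (powScale 1 β)) * (∫ u, φ u * (avgKernel ((L : ℝ) ^ 3 * β) u' u / transferKernel su2Rep ((L : ℝ) ^ 3 * β) (1 : GaugeConfig 3 1 SU2) 1) ∂configMeasure SU2 1)) (fun x : LinkSpace L => {x : LinkSpace L | linkCurry x ∈ capBalancedSet L}.indicator (fun _ => (1 : ℝ)) x * frozenProfile L (fun β' => stiffGaussExp L (β' / 2) β') (fun β' => min (1 / 40) (powScale (1 / 2) β' * btLog β')) β x) U) ^ 2 * softWeight (recordChi L s 43 M β) U) ∂configMeasure SU2 L ≤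
        (((fpZ (powScale 1 β))⁻¹ * (c₁ β * stiffGaussTop L (β / 2) β / (∫ u, ({u : GaugeConfig 3 1 SU2 | (∀ k : Fin 3, ‖su2Quat (u (0, k)) - 1‖ ≤ (powScale (1 / 3) β)) ∧ (L : ℝ) ^ 3 * wilsonAction su2Rep u ≤ (powScale (1 / 2) β)}.indicator (fun _ => (1 : ℝ))) u * (transferKernel su2Rep ((L : ℝ) ^ 3 * β) (1 : GaugeConfig 3 1 SU2) u / transferKernel su2Rep ((L : ℝ) ^ 3 * β) (1 : GaugeConfig 3 1 SU2) 1)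
            ∂configMeasure SU2 1)) * (max (1 - Real.exp (-(coreEta L β (D * powScale s β) ((D * powScale s β) + (14 * powScale s β)) (9 * (L : ℝ) * (5 * (powScale (1 / 2) β * btLog β ^ 2)) + (powScale 1 β)) (min (1 / 40) (powScale (1 / 2) β * btLog β)) ((powScale 1 β) * Fintype.card (Site 3 L)) (powScale (2 * s) β) + coreEps1 L β (D * powScale s β) (9 * (L : ℝ) * (5 * (powScale (1 / 2) β * btLog β ^ 2)) + (powScale 1 β)) (min (1 / 40) (powScale (1 / 2) β * btLog β)) + coreEps2 L β (D * powScale s β) (9 * (L : ℝ) * (5 * (powScale (1 / 2) β * btLog β ^ 2)) + (powScale 1 β)) (min (1 / 40) (powScale (1 / 2) β * btLog β)) (powScale (2 * s) β))) * (1 - powScale (1 / 5) β)) (Real.exp (coreEta L β (D * powScale s β) ((D * powScale s β) + (14 * powScale s β)) (9 * (L : ℝ) * (5 * (powScale (1 / 2) β * btLog β ^ 2)) + (powScale 1 β)) (min (1 / 40) (powScale (1 / 2) β * btLog β)) ((powScale 1 β) * Fintype.card (Site 3 L)) (powScale (2 * s) β) + coreEps1 L β (D * powScale s β) (9 * (L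 : ℝ) * (5 * (powScale (1 / 2) β * btLog β ^ 2)) + (powScale 1 β)) (min (1 / 40) (powScale (1 / 2) β * btLog β)) + coreEps2 L β (D * powScale s β) (9 * (L : ℝ) * (5 * (powScale (1 / 2) β * btLog β ^ 2)) + (powScale 1 β)) (min (1 / 40) (powScale (1 / 2) β * btLog β)) (powScale (2 * s) β)) * (1 + powScale (1 / 5) β) - 1) + (Cp * (43 * powScale s β) ^ 2))) ^ 2 / ((fpWeightBar L (powScale 1 β)) * (1 - (Cp * (43 * powScale s β) ^ 2)))) *
          (∫ v, {v : Edge 3 L → Fin 3 → ℝ | ‖linkEmbed L v‖ ≤ (min (1 / 40) (powScale (1 / 2) β * btLog β)) / 12}.indicator (fun _ => (1 : ℝ)) v *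
            (Real.exp (-((fun β' => stiffGaussExp L (β' / 2) β') β (linkEmbed L v))) ^ 2 * Real.exp (-(‖(gaugeModes L).starProjection (linkEmbed L v)‖ ^ 2 / powScale 1 β ^ 2))) ∂orthoTransverse L) *
          ((linkCE ((L : ℝ) ^ 3 * β) / transferKernel su2Rep ((L : ℝ) ^ 3 * β) (1 : GaugeConfig 3 1 SU2) 1) ^ 2 * ∫ u, φ u ^ 2 ∂configMeasure SU2 1) := by
  -- (P) for the record weight (`δ = 43β^{-s}`, `δg = β^{-1}`)
  have hδ0 : ∀ β, 0 < (fun β : ℝ => 43 * powScale s β) β := fun β => mul_pos (by norm_num) (powScale_pos _ _)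
  have hδt : Tendsto (fun β : ℝ => 43 * powScale s β) atTop (𝓝 0) := by simpa using (tendsto_powScale (σ := s) hs).const_mul 43
  have hsd : ∀ᶠ β in atTop, 0 < powScale 1 β ∧ powScale 1 β ≤ (fun β : ℝ => 43 * powScale s β) β ^ 3 := by
    filter_upwards [eventually_ge_atTop (1 : ℝ)] with β hβ
    refine ⟨powScale_pos _ _, ?_⟩
    have h1 : powScale 1 β ≤ powScale s β ^ 3 := powScale_one_le_cube hs3 hβ
    have h2 : powScale s β ^ 3 ≤ (43 * powScale s β) ^ 3 :=
      pow_le_pow_left₀ (powScale_pos _ _).le (le_mul_of_one_le_left (powScale_pos _ _).le (by norm_num)) 3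
    exact h1.trans h2
  obtain ⟨M₀, hM₀, hPM⟩ := fpWeight_core_constant L hL hδ0 hδt hsd
  refine ⟨M₀, hM₀, fun M hM D hD => ?_⟩
  obtain ⟨c₁, hquasi, hrateD⟩ := core_defect_rate_floor (L := L) hL (s := s) hs
  have hrate := hrateD D
  obtain ⟨Cp, β₀, hCp, hP⟩ := hPM M hM
  refine ⟨c₁, Cp, hCp, ?_⟩
  have eκ : ∀ᶠ β : ℝ in atTop, (Cp * (43 * powScale s β) ^ 2) < 1 := by
    have h := ((tendsto_powScale (σ := s) hs).const_mul 43).pow 2 |>.const_mul Cp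
    rw [mul_zero, zero_pow two_ne_zero, mul_zero] at h
    exact h.eventually (eventually_lt_nhds one_pos)
  have e37 : ∀ᶠ β : ℝ in atTop, (min (1 / 40) (powScale (1 / 2) β * btLog β)) ≤ (9 * (L : ℝ) * (5 * (powScale (1 / 2) β * btLog β ^ 2)) + (powScale 1 β)) := Eventually.of_forall fun β => rf_le_schedT (L := L) β
  filter_upwards [hrate, hquasi, eventually_ge_atTop β₀, eκ, e37, eventually_ge_atTop (1 : ℝ)] with β hR hQ hβ0 hκ1 h37 hβ1
  obtain ⟨hc₁, hdef⟩ := hR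
  refine ⟨hc₁, hκ1, hQ.2, fun φ hφm Cφ hCφ hφw => ?_⟩
  have hβp : (0 : ℝ) < β := by linarith
  have hB : (0 : ℝ) ≤ (L : ℝ) ^ 3 * β := by positivity
  have hK1 : 0 < transferKernel su2Rep ((L : ℝ) ^ 3 * β) (1 : GaugeConfig 3 1 SU2) 1 := transferKernel_pos _ _ _ _
  have hZ : 0 < fpZ (powScale 1 β) := fpZ_pos (powScale_pos 1 β)
  have hZi : 0 ≤ (fpZ (powScale 1 β))⁻¹ := (inv_pos.2 hZ).le
  have hI0 := slowWindow_I0_pos (L := L) (powScale_pos (1 / 3) β) (powScale_pos (1 / 2) β) ((L : ℝ) ^ 3 * β)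
  obtain ⟨hSlo, -⟩ := stiffGaussTop_record_bounds (L := L) hβp
  have hS : 0 < stiffGaussTop L (β / 2) β := lt_of_lt_of_le (pow_pos (Real.sqrt_pos.2 (by positivity)) _) hSlo
  have ha₀ : 0 ≤ (c₁ β * stiffGaussTop L (β / 2) β / (∫ u, ({u : GaugeConfig 3 1 SU2 | (∀ k : Fin 3, ‖su2Quat (u (0, k)) - 1‖ ≤ (powScale (1 / 3) β)) ∧ (L : ℝ) ^ 3 * wilsonAction su2Rep u ≤ (powScale (1 / 2) β)}.indicator (fun _ => (1 : ℝ))) u * (transferKernel su2Rep ((L : ℝ) ^ 3 * β) (1 : GaugeConfig 3 1 SU2) u / transferKernel su2Rep ((L : ℝ) ^ 3 * β) (1 : GaugeConfig 3 1 SU2) 1)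
            ∂configMeasure SU2 1)) := (div_pos (mul_pos hc₁ hS) hI0).le
  have hNbar := fpWeightBar_pos L (powScale_pos 1 β)
  have hκ0 : 0 ≤ (Cp * (43 * powScale s β) ^ 2) := by positivity
  have hNκ : 0 < (fpWeightBar L (powScale 1 β)) * (1 - (Cp * (43 * powScale s β) ^ 2)) := mul_pos hNbar (by linarith)
  have hx0 : 0 < powScale (1 / 2) β := powScale_pos _ _
  have hℓ0 : 0 ≤ btLog β := le_trans zero_le_one (one_le_btLog β)
  have hrf0 : 0 ≤ (min (1 / 40) (powScale (1 / 2) β * btLog β)) := le_min (by norm_num) (mul_nonneg hx0.le hℓ0)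
  -- (P) on the fat tube
  have hPF : ∀ U ∈ (fatTubeRho L (fun β => 43 * powScale s β) (fun b => M * (43 * powScale s b)) β), (fpWeightBar L (powScale 1 β)) * (1 - (Cp * (43 * powScale s β) ^ 2)) ≤ gaugeAvg (recordChi L s 43 M β) U ∧ gaugeAvg (recordChi L s 43 M β) U ≤ (fpWeightBar L (powScale 1 β)) * (1 + (Cp * (43 * powScale s β) ^ 2)) :=
    fun U hU => hP β hβ0 U hU
  -- the data
  have hqfm : ∀ β', Measurable ((fun β'' : ℝ => stiffGaussExp L (β'' / 2) β'') β') := fun β' => measurable_stiffGaussExp _ _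
  have hqf0 : ∀ β' x, 0 ≤ (fun β'' : ℝ => stiffGaussExp L (β'' / 2) β'') β' x := fun β' x => stiffGaussExp_nonneg _ _ x
  have hΩGm : Measurable (frozenProfile L (fun β' => stiffGaussExp L (β' / 2) β') (fun β' => min (1 / 40) (powScale (1 / 2) β' * btLog β')) β) :=
    measurable_frozenProfile hqfm _ β
  have hΩG0 : ∀ x, 0 ≤ frozenProfile L (fun β' => stiffGaussExp L (β' / 2) β') (fun β' => min (1 / 40) (powScale (1 / 2) β' * btLog β')) β x :=
    fun x => (frozenProfile_mem_Icc hqf0 _ β x).1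
  have hΩG1 : ∀ x, |frozenProfile L (fun β' => stiffGaussExp L (β' / 2) β') (fun β' => min (1 / 40) (powScale (1 / 2) β' * btLog β')) β x| ≤ 1 := abs_frozenProfile_le hqf0 _ β
  have hΩm := measurable_capRestrict (L := L) hΩGm
  have hΩdat := fun x => capRestrict_mem (L := L) hΩG0 hΩG1 x
  have hWm := measurable_coreWeight (L := L) (powScale 1 β) (5 * (powScale (1 / 2) β * btLog β ^ 2))
  -- `K_core`, `P`, `P_a`
  have hKm := measurable_coreTransferApply (L := L) β hΩm hWm hφm (fpZ (powScale 1 β))⁻¹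
  have hPm := measurable_slowP ((L : ℝ) ^ 3 * β) (transferKernel su2Rep ((L : ℝ) ^ 3 * β) (1 : GaugeConfig 3 1 SU2) 1) hφm
  have hPam := measurable_slowP ((L : ℝ) ^ 3 * β) (transferKernel su2Rep ((L : ℝ) ^ 3 * β) (1 : GaugeConfig 3 1 SU2) 1) hφm.abs
  obtain ⟨M1, -, hM1⟩ := exists_avgKernel_le (L := 1) ((L : ℝ) ^ 3 * β)
  have hPab : ∀ u', |∫ u, |φ u| * (avgKernel ((L : ℝ) ^ 3 * β) u' u / transferKernel su2Rep ((L : ℝ) ^ 3 * β) (1 : GaugeConfig 3 1 SU2) 1) ∂configMeasure SU2 1| ≤ Cφ * (M1 / transferKernel su2Rep ((L : ℝ) ^ 3 * β) (1 : GaugeConfig 3 1 SU2) 1) :=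
    fun u' => abs_slowP_le hK1 (h := fun u => |φ u|) (fun u => by rw [abs_abs]; exact hCφ u) (fun u'' u => hM1 u'' u) u'
  have hPPa : ∀ u', |(∫ u, φ u * (avgKernel ((L : ℝ) ^ 3 * β) u' u / transferKernel su2Rep ((L : ℝ) ^ 3 * β) (1 : GaugeConfig 3 1 SU2) 1) ∂configMeasure SU2 1)| ≤ ∫ u, |φ u| * (avgKernel ((L : ℝ) ^ 3 * β) u' u / transferKernel su2Rep ((L : ℝ) ^ 3 * β) (1 : GaugeConfig 3 1 SU2) 1) ∂configMeasure SU2 1 := fun u' => abs_slowP_le_slowPa hK1 u'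
  -- the pointwise core defect, multiplied by `Z⁻¹`
  have hcore : ∀ u' ∈ {u : GaugeConfig 3 1 SU2 | (∀ k : Fin 3, ‖su2Quat (u (0, k)) - 1‖ ≤ (D * powScale s β)) ∧ (L : ℝ) ^ 3 * wilsonAction su2Rep u ≤ (powScale (2 * s) β)}, ∀ v' ∈ capBalancedSet L, ‖linkEmbed L v'‖ ≤ (min (1 / 40) (powScale (1 / 2) β * btLog β)) / 12 → orthoTube L u' v' ∈ (fatTubeRho L (fun β => 43 * powScale s β) (fun b => M * (43 * powScale s b)) β) →
      |(fun U : GaugeConfig 3 L SU2 => (fpZ (powScale 1 β))⁻¹ * ∫ u, φ u * (∫ c, fpFibreTransfer L β (fun x : LinkSpace L => {x : LinkSpace L | linkCurry x ∈ capBalancedSet L}.indicator (fun _ => (1 : ℝ)) x * frozenProfile L (fun β' => stiffGaussExp L (β' / 2) β') (fun β' => min (1 / 40) (powScale (1 / 2) β' * btLog β')) β x) (coreWeight L (powScale 1 β) (5 * (powScale (1 / 2) β * btLog β ^ 2))) (gaugeTransform (fun _ : Site 3 L => c⁻¹) U) u ∂haarProbability SU2) ∂configMeasure SU2 1) (orthoTube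 L u' v') - (fpZ (powScale 1 β))⁻¹ * ((c₁ β * stiffGaussTop L (β / 2) β / (∫ u, ({u : GaugeConfig 3 1 SU2 | (∀ k : Fin 3, ‖su2Quat (u (0, k)) - 1‖ ≤ (powScale (1 / 3) β)) ∧ (L : ℝ) ^ 3 * wilsonAction su2Rep u ≤ (powScale (1 / 2) β)}.indicator (fun _ => (1 : ℝ))) u * (transferKernel su2Rep ((L : ℝ) ^ 3 * β) (1 : GaugeConfig 3 1 SU2) u / transferKernel su2Rep ((L : ℝ) ^ 3 * β) (1 : GaugeConfig 3 1 SU2) 1)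
            ∂configMeasure SU2 1)) * Real.exp (-((fun β' => stiffGaussExp L (β' / 2) β') β (linkEmbed L v')))) * (∫ u, φ u * (avgKernel ((L : ℝ) ^ 3 * β) u' u / transferKernel su2Rep ((L : ℝ) ^ 3 * β) (1 : GaugeConfig 3 1 SU2) 1) ∂configMeasure SU2 1)| ≤
        max (1 - Real.exp (-(coreEta L β (D * powScale s β) ((D * powScale s β) + (14 * powScale s β)) (9 * (L : ℝ) * (5 * (powScale (1 / 2) β * btLog β ^ 2)) + (powScale 1 β)) (min (1 / 40) (powScale (1 / 2) β * btLog β)) ((powScale 1 β) * Fintype.card (Site 3 L)) (powScale (2 * s) β) + coreEps1 L β (D * powScale s β) (9 * (L : ℝ) * (5 * (powScale (1 / 2) β * btLog β ^ 2)) + (powScale 1 β)) (min (1 / 40) (powScale (1 / 2) β * btLog β)) + coreEps2 L β (D * powScale s β) (9 * (L : ℝ) * (5 * (powScale (1 / 2) β * btLog β ^ 2)) + (powScale 1 β)) (min (1 / 40) (powScale (1 / 2) β * btLog β)) (powScale (2 * s) β))) * (1 - powScale (1 / 5) β)) (Real.exp (coreEta L β (D * powScale s β) ((D * powScale s β) +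 (14 * powScale s β)) (9 * (L : ℝ) * (5 * (powScale (1 / 2) β * btLog β ^ 2)) + (powScale 1 β)) (min (1 / 40) (powScale (1 / 2) β * btLog β)) ((powScale 1 β) * Fintype.card (Site 3 L)) (powScale (2 * s) β) + coreEps1 L β (D * powScale s β) (9 * (L : ℝ) * (5 * (powScale (1 / 2) β * btLog β ^ 2)) + (powScale 1 β)) (min (1 / 40) (powScale (1 / 2) β * btLog β)) + coreEps2 L β (D * powScale s β) (9 * (L : ℝ) * (5 * (powScale (1 / 2) β * btLog β ^ 2)) + (powScale 1 β)) (min (1 / 40) (powScale (1 / 2) β * btLog β)) (powScale (2 * s) β)) * (1 + powScale (1 / 5) β) - 1) * ((fpZ (powScale 1 β))⁻¹ * ((c₁ β * stiffGaussTop L (β / 2) β / (∫ u, ({u : GaugeConfig 3 1 SU2 | (∀ k : Fin 3, ‖su2Quat (u (0, k)) - 1‖ ≤ (powScale (1 / 3) β)) ∧ (L : ℝ) ^ 3 * wilsonAction su2Rep u ≤ (powScale (1 / 2) β)}.indicator (fun _ => (1 : ℝ))) u * (transferKernel su2Rep ((L : ℝ) ^ 3 * β) (1 : GaugeConfig 3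 1 SU2) u / transferKernel su2Rep ((L : ℝ) ^ 3 * β) (1 : GaugeConfig 3 1 SU2) 1)
            ∂configMeasure SU2 1)) * Real.exp (-((fun β' => stiffGaussExp L (β' / 2) β') β (linkEmbed L v')))) * ∫ u, |φ u| * (avgKernel ((L : ℝ) ^ 3 * β) u' u / transferKernel su2Rep ((L : ℝ) ^ 3 * β) (1 : GaugeConfig 3 1 SU2) 1) ∂configMeasure SU2 1) := by
    intro u' hu' v' hv' hx' _hUF
    obtain ⟨hu'1, hu'2⟩ := hu'
    have hv'T : ∀ e : Edge 3 L, ∑ a, v' e a ^ 2 ≤ (9 * (L : ℝ) * (5 * (powScale (1 / 2) β * btLog β ^ 2)) + (powScale 1 β)) ^ 2 := by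
      intro e
      have h1 : ∑ a, v' e a ^ 2 ≤ ‖linkEmbed L v'‖ ^ 2 := by
        rw [norm_linkEmbed_sq]
        exact Finset.single_le_sum (f := fun e' => ∑ a, v' e' a ^ 2) (fun e' _ => Finset.sum_nonneg fun a _ => sq_nonneg _) (Finset.mem_univ e)
      have h2 : ‖linkEmbed L v'‖ ≤ (9 * (L : ℝ) * (5 * (powScale (1 / 2) β * btLog β ^ 2)) + (powScale 1 β)) := by
        have h12 : (min (1 / 40) (powScale (1 / 2) β * btLog β)) / 12 ≤ (min (1 / 40) (powScale (1 / 2) β * btLog β)) := by linarith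
        exact (hx'.trans h12).trans h37
      exact h1.trans (pow_le_pow_left₀ (norm_nonneg _) h2 2)
    have hd := hdef u' hu'1 hu'2 v' hv' hv'T hx' φ hφm Cφ hCφ hφw
    dsimp only
    have e1 : (fpZ (powScale 1 β))⁻¹ * ((c₁ β * stiffGaussTop L (β / 2) β / (∫ u, ({u : GaugeConfig 3 1 SU2 | (∀ k : Fin 3, ‖su2Quat (u (0, k)) - 1‖ ≤ (powScale (1 / 3) β)) ∧ (L : ℝ) ^ 3 * wilsonAction su2Rep u ≤ (powScale (1 / 2) β)}.indicator (fun _ => (1 : ℝ))) u * (transferKernel su2Rep ((L : ℝ) ^ 3 * β) (1 : GaugeConfig 3 1 SU2) u / transferKernel su2Rep ((L : ℝ) ^ 3 * β) (1 : GaugeConfig 3 1 SU2) 1)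
            ∂configMeasure SU2 1)) * Real.exp (-(stiffGaussExp L (β / 2) β (linkEmbed L v')))) * (∫ u, φ u * (avgKernel ((L : ℝ) ^ 3 * β) u' u / transferKernel su2Rep ((L : ℝ) ^ 3 * β) (1 : GaugeConfig 3 1 SU2) 1) ∂configMeasure SU2 1) =
        (fpZ (powScale 1 β))⁻¹ * (c₁ β * ((stiffGaussTop L (β / 2) β * Real.exp (-stiffGaussExp L (β / 2) β (linkEmbed L v'))) / (∫ u, ({u : GaugeConfig 3 1 SU2 | (∀ k : Fin 3, ‖su2Quat (u (0, k)) - 1‖ ≤ (powScale (1 / 3) β)) ∧ (L : ℝ) ^ 3 * wilsonAction su2Rep u ≤ (powScale (1 / 2) β)}.indicator (fun _ => (1 : ℝ))) u * (transferKernel su2Rep ((L : ℝ) ^ 3 * β) (1 : GaugeConfig 3 1 SU2) u / transferKernel su2Rep ((L : ℝ) ^ 3 * β) (1 : GaugeConfig 3 1 SU2) 1)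
            ∂configMeasure SU2 1)) * (∫ u, φ u * (avgKernel ((L : ℝ) ^ 3 * β) u' u / transferKernel su2Rep ((L : ℝ) ^ 3 * β) (1 : GaugeConfig 3 1 SU2) 1) ∂configMeasure SU2 1)) := by
      field_simp
    have e2 : max (1 - Real.exp (-(coreEta L β (D * powScale s β) ((D * powScale s β) + (14 * powScale s β)) (9 * (L : ℝ) * (5 * (powScale (1 / 2) β * btLog β ^ 2)) + (powScale 1 β)) (min (1 / 40) (powScale (1 / 2) β * btLog β)) ((powScale 1 β) * Fintype.card (Site 3 L)) (powScale (2 * s) β) + coreEps1 L β (D * powScale s β) (9 * (L : ℝ) * (5 * (powScale (1 / 2) β * btLog β ^ 2)) + (powScale 1 β)) (min (1 / 40) (powScale (1 / 2) β * btLog β)) + coreEps2 L β (D * powScale s β) (9 * (L : ℝ) * (5 * (powScale (1 / 2) β * btLog β ^ 2)) + (powScale 1 β)) (min (1 / 40) (powScale (1 / 2) β * btLog β)) (powScale (2 * s) β))) * (1 - powScale (1 / 5) β)) (Real.exp (coreEta L β (D * powScale s β) ((D * powScale s β) + (14 * powScale s β)) (9 * (L : ℝ) * (5 * (powScale (1 /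 2) β * btLog β ^ 2)) + (powScale 1 β)) (min (1 / 40) (powScale (1 / 2) β * btLog β)) ((powScale 1 β) * Fintype.card (Site 3 L)) (powScale (2 * s) β) + coreEps1 L β (D * powScale s β) (9 * (L : ℝ) * (5 * (powScale (1 / 2) β * btLog β ^ 2)) + (powScale 1 β)) (min (1 / 40) (powScale (1 / 2) β * btLog β)) + coreEps2 L β (D * powScale s β) (9 * (L : ℝ) * (5 * (powScale (1 / 2) β * btLog β ^ 2)) + (powScale 1 β)) (min (1 / 40) (powScale (1 / 2) β * btLog β)) (powScale (2 * s) β)) * (1 + powScale (1 / 5) β) - 1) * ((fpZ (powScale 1 β))⁻¹ * ((c₁ β * stiffGaussTop L (β / 2) β / (∫ u, ({u : GaugeConfig 3 1 SU2 | (∀ k : Fin 3, ‖su2Quat (u (0, k)) - 1‖ ≤ (powScale (1 / 3) β)) ∧ (L : ℝ) ^ 3 * wilsonAction su2Rep u ≤ (powScale (1 / 2) β)}.indicator (fun _ => (1 : ℝ))) u * (transferKernel su2Rep ((L : ℝ) ^ 3 * β) (1 : GaugeConfig 3 1 SU2) u / transferKernel su2Rep ((L : ℝ) ^ 3 * β)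 (1 : GaugeConfig 3 1 SU2) 1)
            ∂configMeasure SU2 1)) * Real.exp (-(stiffGaussExp L (β / 2) β (linkEmbed L v')))) * ∫ u, |φ u| * (avgKernel ((L : ℝ) ^ 3 * β) u' u / transferKernel su2Rep ((L : ℝ) ^ 3 * β) (1 : GaugeConfig 3 1 SU2) 1) ∂configMeasure SU2 1) =
        (fpZ (powScale 1 β))⁻¹ * (max (1 - Real.exp (-(coreEta L β (D * powScale s β) ((D * powScale s β) + (14 * powScale s β)) (9 * (L : ℝ) * (5 * (powScale (1 / 2) β * btLog β ^ 2)) + (powScale 1 β)) (min (1 / 40) (powScale (1 / 2) β * btLog β)) ((powScale 1 β) * Fintype.card (Site 3 L)) (powScale (2 * s) β) + coreEps1 L β (D * powScale s β) (9 * (L : ℝ) * (5 * (powScale (1 / 2) β * btLog β ^ 2)) + (powScale 1 β)) (min (1 / 40) (powScale (1 / 2) β * btLog β)) + coreEps2 L β (D * powScale s β) (9 * (L : ℝ) * (5 * (powScale (1 / 2) β * btLog β ^ 2)) + (powScale 1 β)) (min (1 / 40) (powScale (1 / 2) β * btLog β)) (powScale (2 * s) β))) * (1 - powScale (1 / 5)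 β)) (Real.exp (coreEta L β (D * powScale s β) ((D * powScale s β) + (14 * powScale s β)) (9 * (L : ℝ) * (5 * (powScale (1 / 2) β * btLog β ^ 2)) + (powScale 1 β)) (min (1 / 40) (powScale (1 / 2) β * btLog β)) ((powScale 1 β) * Fintype.card (Site 3 L)) (powScale (2 * s) β) + coreEps1 L β (D * powScale s β) (9 * (L : ℝ) * (5 * (powScale (1 / 2) β * btLog β ^ 2)) + (powScale 1 β)) (min (1 / 40) (powScale (1 / 2) β * btLog β)) + coreEps2 L β (D * powScale s β) (9 * (L : ℝ) * (5 * (powScale (1 / 2) β * btLog β ^ 2)) + (powScale 1 β)) (min (1 / 40) (powScale (1 / 2) β * btLog β)) (powScale (2 * s) β)) * (1 + powScale (1 / 5) β) - 1) * (c₁ β * ((stiffGaussTop L (β / 2) β * Real.exp (-stiffGaussExp L (β / 2) β (linkEmbed L v'))) / (∫ u, ({u : GaugeConfig 3 1 SU2 | (∀ k : Fin 3, ‖su2Quat (u (0, k)) - 1‖ ≤ (powScale (1 / 3) β)) ∧ (L : ℝ) ^ 3 * wilsonAction su2Rep u ≤ (powScale (1 / 2) β)}.indicator (fun _ => (1 :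 ℝ))) u * (transferKernel su2Rep ((L : ℝ) ^ 3 * β) (1 : GaugeConfig 3 1 SU2) u / transferKernel su2Rep ((L : ℝ) ^ 3 * β) (1 : GaugeConfig 3 1 SU2) 1)
            ∂configMeasure SU2 1)) * ∫ u, |φ u| * (avgKernel ((L : ℝ) ^ 3 * β) u' u / transferKernel su2Rep ((L : ℝ) ^ 3 * β) (1 : GaugeConfig 3 1 SU2) 1) ∂configMeasure SU2 1)) := by
      field_simp
    rw [e1, e2, ← mul_sub, abs_mul, abs_of_nonneg hZi]
    exact mul_le_mul_of_nonneg_left hd hZi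
  have hmain := defect_core_sq_integral_le (L := L) β (measurableSet_fatTubeRho L _ _ β) (recordChi_eq_indicator_mul (L := L) s 43 M β) hNκ hκ0 hPF
    (q := fun β' => stiffGaussExp L (β' / 2) β') hqfm (fun x => stiffGaussExp_nonneg _ _ x) (fun β' => min (1 / 40) (powScale (1 / 2) β' * btLog β'))
    hKm hPm hPam hPab hPPa hZi ha₀ (le_trans (powScale_pos (1 / 5) β).le (R53S.etac_le_defectConst ?_ (powScale_pos (1 / 5) β).le)) (by linarith [hrf0])
    (measurableSet_slowWindow (L := L) _ _) hcore
  · have hschur := sq_integral_slowPa_le hB hK1 hφm hCφ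
    have hgf0 : ∀ v : Edge 3 L → Fin 3 → ℝ, 0 ≤ {v : Edge 3 L → Fin 3 → ℝ | ‖linkEmbed L v‖ ≤ (min (1 / 40) (powScale (1 / 2) β * btLog β)) / 12}.indicator (fun _ => (1 : ℝ)) v *
        (Real.exp (-((fun β' => stiffGaussExp L (β' / 2) β') β (linkEmbed L v))) ^ 2 * Real.exp (-(‖(gaugeModes L).starProjection (linkEmbed L v)‖ ^ 2 / powScale 1 β ^ 2))) := by
      intro v
      by_cases h : v ∈ {v : Edge 3 L → Fin 3 → ℝ | ‖linkEmbed L v‖ ≤ (min (1 / 40) (powScale (1 / 2) β * btLog β)) / 12}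
      · rw [Set.indicator_of_mem h]; positivity
      · rw [Set.indicator_of_notMem h, zero_mul]
    exact hmain.trans (mul_le_mul_of_nonneg_left hschur (mul_nonneg (div_nonneg (sq_nonneg _) hNκ.le) (integral_nonneg hgf0)))
  · -- `0 ≤ η_s`
    have hβ0' : (0 : ℝ) ≤ β := hβp.le
    have hT0 := R52.schedT_nonneg (L := L) β
    have hδ0' : 0 ≤ (D * powScale s β) := mul_nonneg hD (powScale_pos _ _).le
    have hΓ0 : 0 ≤ ((powScale 1 β) * Fintype.card (Site 3 L)) := mul_nonneg (powScale_pos _ _).le (Nat.cast_nonneg _)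
    exact add_nonneg (add_nonneg (coreEta_nonneg hβ0' hδ0' (add_nonneg hδ0' (mul_nonneg (by norm_num) (powScale_pos _ _).le)) hT0 hΓ0 (powScale_pos _ _).le)
      (coreEps1_nonneg hβ0' hδ0' hT0)) (coreEps2_nonneg hβ0' hT0 (powScale_pos _ _).le)

end Summit.QuantumFields.YangMills.Theorems.FemtoTransferGap.TwoLattice.ConstTube

end
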